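import Literature.Analysis.FluidPDE.ParabolicWeakMaxPointwise
import HarnessLib

/-!
# The weak parabolic maximum principle on a non-cylindrical (shrinking) domain

Analysis/FluidPDE proof file (no definitions, no named facts, no `sorry`). Lieberman's weak maximum
principle (1996, Ch. II, Lemma 2.1 with Lemma 2.3) is stated for a general bounded space–time domain
`Ω` with its parabolic boundary `𝒫Ω`; the tree's `weak_max_principle` /
`weak_max_principle_of_contDiffAt` record the cylindrical case `Ω = (T₁, T₂] × K`. This file records
the case of a domain whose slices SHRINK in time,
`Ω = {(t, x) : T₁ ≤ t ≤ T₂, x ∈ K(t)}`, `K(t) ⊆ K(s)` for `s ≤ t`, with open `U(t) ⊆ K(t)` where the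
differential inequality is used; the parabolic boundary is `K(T₁)` at `t = T₁` together with
`K(t) ∖ U(t)` at each time (for shrinking slices no part of the lateral boundary is "future-facing",
so the one-sided-in-time argument of the cylindrical case applies verbatim: a maximum point
`(t', x')` with `x' ∈ U(t')` has `(s, x') ∈ Ω` for all `s ≤ t'`).

* `weak_max_principle_shrinking` — slices `K(t)` inside a fixed compact `K₀`, graph of `K` over
  `[T₁, T₂]` closed, `K` antitone, `U(t) ⊆ K(t)` open; `w` jointly continuous on the graph,
  `ContDiffAt ℝ 2 (w t) x` and a left time derivative on `U(t)`, `t ∈ (T₁, T₂]`, the sub-solution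
  implication `∇w = 0 → Δw ≤ 0 → wₜ ≤ 0` there, `w ≤ 0` on the parabolic boundary ⟹ `w ≤ 0` on `Ω`.

Consumer: the swirl-rate barrier on the shrinking balls `|x − c| ≤ ℓ(t)`
(`Summits/…/FluidComputer/SwirlRateBarrier.lean`, seat `ns-blowup-ecbridge-2` g13).

## References

* G. M. Lieberman, *Second order parabolic differential equations*, World Scientific 1996,
  Ch. II, Lemma 2.1, Lemma 2.3 (general domains `Ω` with parabolic boundary `𝒫Ω`).
  [`Lieberman1996`]
-/

noncomputable section

open MeasureTheory Set Function Filter Topology Metric InnerProductSpace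
open scoped RealInnerProductSpace Laplacian ContDiff NNReal

namespace Literature.Analysis.FluidPDE

section WeakMaxShrinking

variable {E : Type*} [NormedAddCommGroup E] [InnerProductSpace ℝ E] [FiniteDimensional ℝ E]

/-- **Weak parabolic maximum principle on a domain with shrinking slices** (Lieberman 1996, Ch. II,
Lemma 2.1 with Lemma 2.3, for `Ω = {(t, x) : T₁ ≤ t ≤ T₂, x ∈ K(t)}` with `K` antitone): `K(t) ⊆ K₀`
compact, the graph `{(t, x) : t ∈ [T₁, T₂], x ∈ K(t)}` closed, `U(t) ⊆ K(t)` open; `w` jointly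
continuous on the graph, with `ContDiffAt ℝ 2 (w t) x` and a left time derivative `wₜ t x` (within
`[T₁, t]`) at the points `x ∈ U(t)`, `t ∈ (T₁, T₂]`; the sub-solution implication
`∇(w t)(x) = 0 → Δ(w t)(x) ≤ 0 → wₜ t x ≤ 0` there; and `w ≤ 0` on the parabolic boundary (`K(T₁)` at
`t = T₁`; `K(t) ∖ U(t)` for every `t`). Then `w ≤ 0` on the graph. Proof as in the cylindrical
`weak_max_principle_of_contDiffAt`: a positive value forces a positive maximum of `w − θ(t − T₁)`
on the compact graph, off the parabolic boundary; there `∇w = 0`, `Δw ≤ 0`, and — the slices being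
antitone, `(s, x') ∈ Ω` for `s ≤ t'` — the left derivative gives `wₜ ≥ θ > 0`.
[cite: Lieberman1996, Ch. II Lemma 2.1 and Lemma 2.3] -/
theorem weak_max_principle_shrinking {K U : ℝ → Set E} {K₀ : Set E} {T₁ T₂ : ℝ}
    (hK₀ : IsCompact K₀) (hKsub : ∀ t ∈ Icc T₁ T₂, K t ⊆ K₀)
    (hgraph : IsClosed {p : ℝ × E | p.1 ∈ Icc T₁ T₂ ∧ p.2 ∈ K p.1})
    (hanti : ∀ s t, T₁ ≤ s → s ≤ t → t ≤ T₂ → K t ⊆ K s)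
    (hU : ∀ t, IsOpen (U t)) (hUK : ∀ t, U t ⊆ K t)
    {w wₜ : ℝ → E → ℝ}
    (hc : ContinuousOn (uncurry w) {p : ℝ × E | p.1 ∈ Icc T₁ T₂ ∧ p.2 ∈ K p.1})
    (h2 : ∀ t ∈ Ioc T₁ T₂, ∀ x ∈ U t, ContDiffAt ℝ 2 (w t) x)
    (ht : ∀ t ∈ Ioc T₁ T₂, ∀ x ∈ U t, HasDerivWithinAt (fun s => w s x) (wₜ t x) (Icc T₁ t) t)
    (hsub : ∀ t ∈ Ioc T₁ T₂, ∀ x ∈ U t, fderiv ℝ (w t) x = 0 → (Δ (w t)) x ≤ 0 → wₜ t x ≤ 0)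
    (hbot : ∀ x ∈ K T₁, w T₁ x ≤ 0)
    (hlat : ∀ t ∈ Icc T₁ T₂, ∀ x ∈ K t \ U t, w t x ≤ 0) :
    ∀ t ∈ Icc T₁ T₂, ∀ x ∈ K t, w t x ≤ 0 := by
  by_contra H
  push Not at H
  obtain ⟨t₀, ht₀, x₀, hx₀, hpos⟩ := H
  set δ : ℝ := w t₀ x₀ with hδ
  set θ : ℝ := δ / (2 * (T₂ - T₁ + 1)) with hθ
  have hT : T₁ ≤ T₂ := ht₀.1.trans ht₀.2
  have hθpos : 0 < θ := div_pos hpos (by linarith)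
  have hθδ : θ * (t₀ - T₁) < δ := by
    have h1 : θ * (t₀ - T₁) ≤ θ * (T₂ - T₁ + 1) :=
      mul_le_mul_of_nonneg_left (by linarith [ht₀.2]) hθpos.le
    have h2 : θ * (T₂ - T₁ + 1) = δ / 2 := by
      rw [hθ, div_mul_eq_mul_div, mul_div_mul_right _ _ (by linarith : (T₂ - T₁ + 1) ≠ 0)]
    linarith
  set S : Set (ℝ × E) := {p : ℝ × E | p.1 ∈ Icc T₁ T₂ ∧ p.2 ∈ K p.1} with hS
  have hSc : IsCompact S := by
    refine ((isCompact_Icc (a := T₁) (b := T₂)).prod hK₀).of_isClosed_subset hgraph fun p hp => ?_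
    exact mk_mem_prod hp.1 (hKsub p.1 hp.1 hp.2)
  set g : ℝ × E → ℝ := fun p => w p.1 p.2 - θ * (p.1 - T₁) with hg
  have hgc : ContinuousOn g S := by
    have h3 : Continuous fun p : ℝ × E => θ * (p.1 - T₁) := by fun_prop
    exact hc.sub h3.continuousOn
  obtain ⟨⟨t', x'⟩, ⟨ht', hx'⟩, hmax⟩ := hSc.exists_isMaxOn ⟨(t₀, x₀), ht₀, hx₀⟩ hgc
  simp only at ht' hx'
  have hmax' : ∀ t ∈ Icc T₁ T₂, ∀ x ∈ K t, w t x - θ * (t - T₁) ≤ w t' x' - θ * (t' - T₁) :=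
    fun t ht x hx => hmax (show (t, x) ∈ S from ⟨ht, hx⟩)
  have hgpos : 0 < w t' x' - θ * (t' - T₁) := by
    have := hmax' t₀ ht₀ x₀ hx₀
    linarith
  have hwpos : 0 < w t' x' := by
    have : 0 ≤ θ * (t' - T₁) := mul_nonneg hθpos.le (by linarith [ht'.1])
    linarith
  have ht'1 : T₁ < t' := by
    rcases eq_or_lt_of_le ht'.1 with h | h
    · exfalso
      have hb := hbot x' (by rw [h]; exact hx')
      rw [h] at hb
      linarith
    · exact h
  have hx'U : x' ∈ U t' := by
    by_contra hxU
    have hl := hlat t' ht' x' ⟨hx', hxU⟩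
    linarith
  have ht'I : t' ∈ Ioc T₁ T₂ := ⟨ht'1, ht'.2⟩
  have hloc : IsLocalMax (w t') x' := by
    filter_upwards [(hU t').mem_nhds hx'U] with x hx
    have := hmax' t' ht' x (hUK t' hx)
    linarith
  have hgrad : fderiv ℝ (w t') x' = 0 := hloc.fderiv_eq_zero
  have hlap : (Δ (w t')) x' ≤ 0 :=
    Literature.Analysis.PDE.LoewnerNirenberg.laplacian_nonpos_of_isLocalMax hloc (h2 t' ht'I x' hx'U)
  have hwt : wₜ t' x' ≤ 0 := hsub t' ht'I x' hx'U hgrad hlap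
  have hderiv : HasDerivWithinAt (fun s => w s x' - θ * (s - T₁)) (wₜ t' x' - θ) (Icc T₁ t') t' := by
    have h1 := ht t' ht'I x' hx'U
    have h2 : HasDerivWithinAt (fun s : ℝ => θ * (s - T₁)) θ (Icc T₁ t') t' := by
      have := ((hasDerivAt_id t').sub_const T₁).const_mul θ
      simpa using this.hasDerivWithinAt
    exact h1.sub h2
  -- the slices are antitone: `x' ∈ K(s)` for `s ≤ t'`
  have hmaxOn : IsLocalMaxOn (fun s => w s x' - θ * (s - T₁)) (Icc T₁ t') t' :=
    Filter.eventually_of_mem self_mem_nhdsWithin fun s hs =>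
      hmax' s ⟨hs.1, hs.2.trans ht'.2⟩ x' (hanti s t' hs.1 hs.2 ht'.2 hx')
  have hcone : T₁ - t' ∈ posTangentConeAt (Icc T₁ t') t' := by
    have hseg : segment ℝ t' T₁ ⊆ Icc T₁ t' := by
      rw [segment_symm, segment_eq_Icc ht'1.le]
    exact sub_mem_posTangentConeAt_of_segment_subset hseg
  have key : (T₁ - t') * (wₜ t' x' - θ) ≤ 0 := by
    simpa using hmaxOn.hasFDerivWithinAt_nonpos hderiv.hasFDerivWithinAt hcone
  have hneg : T₁ - t' < 0 := by linarith
  have : 0 ≤ wₜ t' x' - θ := by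
    by_contra hcon
    push Not at hcon
    have := mul_pos_of_neg_of_neg hneg hcon
    linarith
  linarith

end WeakMaxShrinking

end Literature.Analysis.FluidPDE

end
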